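import Summits.ResolutionOfSingularities.ResolutionOfSingularities.Theorems.PurelyInseparableDim4ResConeLedgerPersist
import Summits.ResolutionOfSingularities.ResolutionOfSingularities.Theorems.PurelyInseparableDim4ResConePowerConeWitness
import Summits.ResolutionOfSingularities.ResolutionOfSingularities.Theorems.PurelyInseparableDim4ResConeLedgerLinear
import Literature.RingTheory.MvPolynomial.VariableIdeals
import HarnessLib
import HarnessLib.Audit.Tags

/-!
# Purely inseparable four-folds — the TRIPLE-MERGED level-2 ledger: merge, transport, reset
# (cell `res-dim4-pi`, K2(p) lane, slice B brick K22)

[OURS · counted 0 · cell `res-dim4-pi` · K2(p) lane holder res-dim4-p-12 g3's brick by signature (bus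
2026-08-29 00:34Z, SLICE-B-ARCH v1.6 K7 route A∞(T); exponent ⚑ idea-4 g3 00:35Z adopted), seat res-dim4-p-9 g3.]
Nothing here proves K2(p)/K2(5), `NoIsolatedTrap p p` or resolution of singularities in dimension ≥ 4 /
characteristic `p`; this is bookkeeping of the light regime (I-4-7 class A∞: three stretch-born letters).

* §1 **`mem_span_mul3_of_mem`** — UFD merge of two pairwise-merged ledgers: `G ∈ (x_a x_b, h^d) ∩ (x_a x_c, h^d)`
  with `h ∉ (x_a, x_b)`, `h ∉ (x_b, x_c)`, `b ≠ c` ⇒ `G ∈ (x_a x_b x_c, h^d)` (primes `(x_a)`, `(x_b, x_c)` and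
  `X_dvd_mul_iff`, the route of res-dim4-p-12's K2 `mem_span_mul_of_mem_span_of_mem_span`).
* §2 **`levelTwo_transport_triple`** — at a SELF-chart step (chart letter `j` = the re-created ledger letter, the
  other two `μ, ν` kept, `1 ≤ r_μ, r_ν ≤ q − 2`, `o + 2 ≤ 2q`) a triple-merged ledger
  `u·G = S·(x_j x_μ x_ν) + T·h^d` with `ord S ≥ d − 2` (`d = o − |r| ≥ 2`) transports as
  `T₀u·G′ = S′·(x_j x_μ x_ν) + (U·T₀T)·(T₁h)^d`, `S′ ≡ U·chartTransform (d−2) (shear j b S) (mod x_j x_μ x_ν)`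
  (`σ_j(x_j x_μ x_ν · S) = x_j³ x_μ x_ν · x_j^{d−2} · T_{d−2}(shear S)`; `d = 3`: `T₁` and `S ∈ 𝔪₀`); the deleted
  `q`-th powers lie in `(x_j² x_μ² x_ν²)` (`E_j − r′_j ≥ 2q − o ≥ 2`, `E_μ − r_μ ≥ q − r_μ ≥ 2`).
* §3 **`chartTransform_one_shear_sub_linear_mem_span_X`** — THE RESET: modulo the new letter `x_j`, `T₁` of a
  polynomial `P ∈ 𝔪₀` is its LINEAR SHADOW `σ(w) + Σ_{i ≠ j} σ_i x_i` (`σ = lin P`, `w = e_j + b`).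

bears_on: LADDER-RESOLUTION:D157-DOOR2 (res-dim4-pi · K2(p) · slice B · K22).  Supports
stmt-ResolutionOfSingularities-16155 (helper).
-/

set_option linter.dupNamespace false -- mandated namespace of this single-conjunct summit

noncomputable section

namespace Summit.ResolutionOfSingularities.ResolutionOfSingularities.Theorems.PIDim4

namespace ResCone

open MvPolynomial Finset
open Literature.AlgebraicGeometry.Resolution
open Literature.AlgebraicGeometry.Resolution.CentreBlowup
open Literature.AlgebraicGeometry.Resolution.Hauser2010
open Literature.AlgebraicGeometry.Resolution.HauserPerlega2019

variable {K : Type} [Field K]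

/-! ## 1. The UFD merge of two pairwise-merged ledgers -/

/-- **Triple merge** (brick K22 (i)): `G ∈ (x_a x_b, h^d)` and `G ∈ (x_a x_c, h^d)` with `h ∉ (x_a, x_b)`,
`h ∉ (x_b, x_c)`, `b ≠ c` give `G ∈ (x_a x_b x_c, h^d)`: from `S x_a x_b + T h^d = S′ x_a x_c + T′ h^d` get
`x_a ∣ T − T′`, then `γ h^d ∈ (x_b, x_c)` forces `γ ∈ (x_b, x_c)`, and `x_c ∣ x_b (S + α h^d)` gives `S ∈ (x_c, h^d)`.
[folklore] -/
theorem mem_span_mul3_of_mem {a b c : Fin 4} (hbc : b ≠ c) {h G : MvPolynomial (Fin 4) K} {d : ℕ}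
    (hh : h ∉ Ideal.span {(X a : MvPolynomial (Fin 4) K), X b} ∧
      h ∉ Ideal.span {(X a : MvPolynomial (Fin 4) K), X c} ∧ h ∉ Ideal.span {(X b : MvPolynomial (Fin 4) K), X c})
    (hab : G ∈ Ideal.span {(X a * X b : MvPolynomial (Fin 4) K), h ^ d})
    (hac : G ∈ Ideal.span {(X a * X c : MvPolynomial (Fin 4) K), h ^ d}) :
    G ∈ Ideal.span {(X a * X b * X c : MvPolynomial (Fin 4) K), h ^ d} := by
  classical
  haveI hPbc : (Ideal.span {(X b : MvPolynomial (Fin 4) K), X c}).IsPrime := by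
    have := Literature.RingTheory.MvPolynomial.isPrime_span_X_image (R := K) ({b, c} : Set (Fin 4))
    rwa [Set.image_pair] at this
  haveI hPa : (Ideal.span {(X a : MvPolynomial (Fin 4) K)}).IsPrime := by
    have := Literature.RingTheory.MvPolynomial.isPrime_span_X_image (R := K) ({a} : Set (Fin 4))
    rwa [Set.image_singleton] at this
  obtain ⟨S, T, hST⟩ := Ideal.mem_span_pair.mp hab
  obtain ⟨S', T', hST'⟩ := Ideal.mem_span_pair.mp hac
  -- `(T − T′) h^d ∈ (x_a)`, hence `T − T′ = γ x_a`
  have hha : h ∉ Ideal.span {(X a : MvPolynomial (Fin 4) K)} := fun hm =>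
    hh.1 (Ideal.span_mono (Set.singleton_subset_iff.mpr (Set.mem_insert _ _)) hm)
  have hdiff : (T - T') * h ^ d ∈ Ideal.span {(X a : MvPolynomial (Fin 4) K)} :=
    Ideal.mem_span_singleton'.mpr ⟨S' * X c - S * X b, by linear_combination hST' - hST⟩
  obtain ⟨γ, hγ⟩ := Ideal.mem_span_singleton'.mp
    ((hPa.mem_or_mem hdiff).resolve_right fun hp => hha (hPa.mem_of_pow_mem d hp))
  -- `γ h^d = S′ x_c − S x_b ∈ (x_b, x_c)`, hence `γ ∈ (x_b, x_c)`
  have hcancel : S' * X c - S * X b = γ * h ^ d := by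
    have h1 : (X a : MvPolynomial (Fin 4) K) * (S' * X c - S * X b) = X a * (γ * h ^ d) := by
      linear_combination hST' - hST - h ^ d * hγ
    exact mul_left_cancel₀ (X_ne_zero a) h1
  have hγmem : γ * h ^ d ∈ Ideal.span {(X b : MvPolynomial (Fin 4) K), X c} :=
    Ideal.mem_span_pair.mpr ⟨-S, S', by rw [← hcancel]; ring⟩
  have hhbc : h ^ d ∉ Ideal.span {(X b : MvPolynomial (Fin 4) K), X c} := fun hp => hh.2.2 (hPbc.mem_of_pow_mem d hp)
  obtain ⟨α, β, hαβ⟩ := Ideal.mem_span_pair.mp ((hPbc.mem_or_mem hγmem).resolve_right hhbc)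
  -- `x_c ∣ x_b (S + α h^d)`, hence `S + α h^d = x_c w`
  have hdvd : (X c : MvPolynomial (Fin 4) K) ∣ X b * (S + α * h ^ d) :=
    ⟨S' - β * h ^ d, by linear_combination h ^ d * hαβ - hcancel⟩
  rcases X_dvd_mul_iff.mp hdvd with hX | ⟨w, hw⟩
  · exact absurd (X_dvd_X.mp hX) (Ne.symm hbc)
  · refine Ideal.mem_span_pair.mpr ⟨w, T - α * (X a * X b), ?_⟩
    linear_combination hST - X a * X b * hw

/-! ## 2. Transport of the triple-merged ledger through a self-chart step -/

section Step

variable [DecidableEq K]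

/-- The deleted `q`-th powers of a step at the chart of the re-created letter `x_j` keeping `μ ≠ ν`
(`1 ≤ r_μ, r_ν ≤ q − 2`, `q < o ≤ 2q − 2`) lie in `(x_j² x_μ² x_ν²)`: `E_j − r′_j ≥ 2q − o ≥ 2` and
`E_μ − r_μ ≥ q − r_μ ≥ 2`. [folklore] -/
theorem deleted_mem_span_sq_triple {q : ℕ} (j : Fin 4) {b : Fin 4 → K} (hbj : b j = 0) {s : State K} {o : ℕ}
    (ho : ordZero s.F = o) (hr : ∀ d ∈ s.F.support, s.r ≤ d) (hqo : q < o) (ho2 : o + 2 ≤ 2 * q) {μ ν : Fin 4}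
    (hjμ : j ≠ μ) (hjν : j ≠ ν) (hμν : μ ≠ ν) (hbμ : b μ = 0) (hbν : b ν = 0) (hrμ : 1 ≤ s.r μ)
    (hrμq : s.r μ + 2 ≤ q) (hrν : 1 ≤ s.r ν) (hrνq : s.r ν + 2 ≤ q) :
    ∑ E ∈ (chartTransform q Finset.univ j (shear j b s.F)).support with IsPthPowerExponent q E,
        monomial (E - (CentreBlowup.step q Finset.univ j b s).r)
          (coeff E (chartTransform q Finset.univ j (shear j b s.F))) ∈
      Ideal.span {((X j * X μ * X ν) ^ 2 : MvPolynomial (Fin 4) K)} := by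
  set r' := (CentreBlowup.step q Finset.univ j b s).r with hr'
  have hr'j : r' j = o - q := by
    rw [hr', step_r_univ q j hbj s ho hr, Finsupp.update_apply, if_pos rfl]
  have hr'μ : r' μ = s.r μ := by
    rw [hr', step_r_univ q j hbj s ho hr, Finsupp.update_apply, if_neg hjμ.symm, Finsupp.filter_apply, if_pos hbμ]
  have hr'ν : r' ν = s.r ν := by
    rw [hr', step_r_univ q j hbj s ho hr, Finsupp.update_apply, if_neg hjν.symm, Finsupp.filter_apply, if_pos hbν]
  refine Ideal.sum_mem _ fun E hE => ?_
  obtain ⟨hEs, hP⟩ := Finset.mem_filter.mp hE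
  have hle : r' ≤ E := step_r_le_of_mem_support_chartTransform_shear j hbj ho hr hqo.le hEs
  have hEj : q ≤ E j := Nat.le_of_dvd (by have := hle j; omega) ((isPthPowerExponent_iff q E).mp hP j)
  have hEμ : q ≤ E μ := Nat.le_of_dvd (by have := hle μ; omega) ((isPthPowerExponent_iff q E).mp hP μ)
  have hEν : q ≤ E ν := Nat.le_of_dvd (by have := hle ν; omega) ((isPthPowerExponent_iff q E).mp hP ν)
  have h2j : 2 ≤ (E - r') j := by rw [Finsupp.tsub_apply, hr'j]; omega
  have h2μ : 2 ≤ (E - r') μ := by rw [Finsupp.tsub_apply, hr'μ]; omega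
  have h2ν : 2 ≤ (E - r') ν := by rw [Finsupp.tsub_apply, hr'ν]; omega
  set m : Fin 4 →₀ ℕ := Finsupp.single j 2 + Finsupp.single μ 2 + Finsupp.single ν 2 with hm
  have hle2 : m ≤ E - r' := by
    intro i
    rw [hm, Finsupp.add_apply, Finsupp.add_apply]
    by_cases hij : i = j
    · rw [hij, Finsupp.single_eq_same, Finsupp.single_eq_of_ne hjμ, Finsupp.single_eq_of_ne hjν]; omega
    · by_cases hiμ : i = μ
      · rw [hiμ, Finsupp.single_eq_of_ne (Ne.symm hjμ), Finsupp.single_eq_same, Finsupp.single_eq_of_ne hμν]; omega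
      · by_cases hiν : i = ν
        · rw [hiν, Finsupp.single_eq_of_ne (Ne.symm hjν), Finsupp.single_eq_of_ne (Ne.symm hμν),
            Finsupp.single_eq_same]; omega
        · rw [Finsupp.single_eq_of_ne hij, Finsupp.single_eq_of_ne hiμ, Finsupp.single_eq_of_ne hiν]; omega
  refine Ideal.mem_span_singleton.mpr ⟨monomial (E - r' - m)
    (coeff E (chartTransform q Finset.univ j (shear j b s.F))), ?_⟩
  rw [show ((X j * X μ * X ν) ^ 2 : MvPolynomial (Fin 4) K) = monomial m 1 by
      rw [hm, mul_pow, mul_pow, X_pow_eq_monomial, X_pow_eq_monomial, X_pow_eq_monomial, monomial_mul,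
        monomial_mul, one_mul, one_mul],
    monomial_mul, one_mul, add_tsub_cancel_of_le hle2]

/-- **TRIPLE-MERGED TRANSPORT** (brick K22 (ii); I-4-7 A∞): at the chart of the re-created ledger letter `x_j`,
keeping the other two `μ ≠ ν` (`b_μ = b_ν = 0`, `1 ≤ r_μ, r_ν ≤ q − 2`), for a state with `x^r ∣ F`,
`q < ord₀ F = o ≤ 2q − 2`, `d = o − |r| ≥ 2`, a triple ledger `u·G = S·(x_j x_μ x_ν) + T·h^d` of the residual
(`h ∈ 𝔪₀`, `ord S ≥ d − 2`) transports as `T₀u·G′ = S′·(x_j x_μ x_ν) + (U·T₀T)·(T₁h)^d` with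
`S′ ≡ U · chartTransform (d−2) (shear j b S) (mod x_j x_μ x_ν)` — for `d = 3` the cofactor transforms with
exponent `1`, like a contact polynomial. [OURS] [cite: CossartJannsenSaito2020, Thm. 3.10(4), Thm. 9.3] -/
theorem levelTwo_transport_triple {q : ℕ} (j : Fin 4) {b : Fin 4 → K} (hbj : b j = 0) {s : State K} {o : ℕ}
    (ho : ordZero s.F = o) (hr : ∀ d ∈ s.F.support, s.r ≤ d) (hqo : q < o) (ho2 : o + 2 ≤ 2 * q) {μ ν : Fin 4}
    (hjμ : j ≠ μ) (hjν : j ≠ ν) (hμν : μ ≠ ν) (hbμ : b μ = 0) (hbν : b ν = 0) (hrμ : 1 ≤ s.r μ)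
    (hrμq : s.r μ + 2 ≤ q) (hrν : 1 ≤ s.r ν) (hrνq : s.r ν + 2 ≤ q) (hd2 : 2 ≤ o - s.r.degree)
    {h u S T : MvPolynomial (Fin 4) K} (hh : h ∈ originIdeal K)
    (hG : u * s.F.divMonomial s.r = S * (X j * X μ * X ν) + T * h ^ (o - s.r.degree))
    (hS : ∀ m ∈ S.support, o - s.r.degree - 2 ≤ m.degree) :
    ∃ S' : MvPolynomial (Fin 4) K,
      chartTransform 0 Finset.univ j (shear j b u) *
          ((CentreBlowup.step q Finset.univ j b s).F.divMonomial (CentreBlowup.step q Finset.univ j b s).r) =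
        S' * (X j * X μ * X ν) +
          ((∏ i ∈ Finset.univ.filter (fun i => b i ≠ 0), (X i + C (b i)) ^ (s.r i)) *
            chartTransform 0 Finset.univ j (shear j b T)) *
            chartTransform 1 Finset.univ j (shear j b h) ^ (o - s.r.degree) ∧
      S' - (∏ i ∈ Finset.univ.filter (fun i => b i ≠ 0), (X i + C (b i)) ^ (s.r i)) *
          chartTransform (o - s.r.degree - 2) Finset.univ j (shear j b S) ∈
        Ideal.span {(X j * X μ * X ν : MvPolynomial (Fin 4) K)} := by
  set d := o - s.r.degree with hd
  set G := s.F.divMonomial s.r with hGdef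
  set r' := (CentreBlowup.step q Finset.univ j b s).r with hr'
  set G' := (CentreBlowup.step q Finset.univ j b s).F.divMonomial r' with hG'def
  set U0 : MvPolynomial (Fin 4) K :=
    ∏ i ∈ Finset.univ.filter (fun i => b i ≠ 0), (X i + C (b i)) ^ (s.r i) with hU0
  -- (i) the deleted part is `(x_j x_μ x_ν)² · c`
  obtain ⟨c, hc⟩ := Ideal.mem_span_singleton.mp
    (deleted_mem_span_sq_triple j hbj ho hr hqo ho2 hjμ hjν hμν hbμ hbν hrμ hrμq hrν hrνq)
  -- degrees
  have hGdeg : ∀ e ∈ G.support, d ≤ e.degree := forall_le_degree_divMonomial ho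
  have huG : ∀ e ∈ (u * G).support, d ≤ e.degree := by
    have h1 := forall_le_degree_mul (fun _ _ => Nat.zero_le _) hGdeg (P := u)
    simpa only [Nat.zero_add] using h1
  have hh1 : ∀ e ∈ h.support, 1 ≤ e.degree := forall_one_le_degree_of_mem_originIdeal hh
  -- (ii) the transform of the ledger identity: `T_d(uG) = x_j x_μ x_ν · T_{d−2}S + T₀T · (T₁h)^d`
  have hshear : shear j b (u * G) = shear j b S * (X j * X μ * X ν) + shear j b T * shear j b h ^ d := by
    rw [hGdef, hG]
    unfold shear
    simp only [map_add, map_mul, map_pow, aeval_X, if_true, if_neg hjμ.symm, if_neg hjν.symm, hbμ, hbν, C_0,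
      zero_mul, add_zero]
  have key : chartTransform d Finset.univ j (shear j b (u * G)) =
      (X j * X μ * X ν) * chartTransform (d - 2) Finset.univ j (shear j b S) +
        chartTransform 0 Finset.univ j (shear j b T) * chartTransform 1 Finset.univ j (shear j b h) ^ d := by
    apply mul_left_cancel₀ (pow_ne_zero d (X_ne_zero j))
    rw [X_pow_mul_chartTransform_univ j (forall_le_degree_shear j b huG), hshear, map_add, map_mul, map_mul,
      map_mul, map_mul, map_pow, ← X_pow_mul_chartTransform_univ j (forall_le_degree_shear j b hS),
      ← X_pow_mul_chartTransform_univ j (forall_le_degree_shear j b hh1),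
      ← X_pow_mul_chartTransform_univ j (fun _ _ => Nat.zero_le _) (m := 0) (P := shear j b T),
      coordBlowupSubst_X_self,
      coordBlowupSubst_X_of_mem_of_ne K _ j (Finset.mem_coe.mpr (Finset.mem_univ μ)) hjμ.symm,
      coordBlowupSubst_X_of_mem_of_ne K _ j (Finset.mem_coe.mpr (Finset.mem_univ ν)) hjν.symm, pow_one,
      mul_pow, pow_zero, one_mul,
      show (X j : MvPolynomial (Fin 4) K) ^ d = X j ^ (d - 2) * X j * X j by
        rw [mul_assoc, ← pow_two, ← pow_add, Nat.sub_add_cancel hd2]]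
    ring
  -- (iii) `T₀u · T_dG = T_d(uG)`
  have hprod : chartTransform 0 Finset.univ j (shear j b u) * chartTransform d Finset.univ j (shear j b G) =
      chartTransform d Finset.univ j (shear j b (u * G)) := by
    rw [shear_mul, ← chartTransform_mul j (fun _ _ => Nat.zero_le _) (forall_le_degree_shear j b hGdeg),
      Nat.zero_add]
  -- (iv) the cleaned new residual (K5(a))
  have hG' : G' = U0 * chartTransform d Finset.univ j (shear j b G) - (X j * X μ * X ν) ^ 2 * c := by
    rw [← hc]; exact eq_sub_of_add_eq (divMonomial_step_F_add_deleted j hbj ho hr hqo.le)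
  refine ⟨U0 * chartTransform (d - 2) Finset.univ j (shear j b S) -
    chartTransform 0 Finset.univ j (shear j b u) * (X j * X μ * X ν) * c, ?_, ?_⟩
  · rw [hG', mul_sub, mul_left_comm, hprod, key]
    ring
  · rw [sub_sub_cancel_left]
    exact Submodule.neg_mem _ (Ideal.mul_mem_right _ _ (Ideal.mul_mem_left _ _ (Ideal.subset_span rfl)))

end Step

/-! ## 3. The reset: modulo the new letter, `T₁` of a polynomial vanishing at `0` is its linear shadow -/

/-- The degree-`1` component is the linear form of the `e_i`-coefficients. [folklore] -/
theorem homogeneousComponent_one_eq_linearForm (P : MvPolynomial (Fin 4) K) :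
    homogeneousComponent 1 P = ∑ i, C (coeff (Finsupp.single i 1) P) * X i := by
  classical
  have hhom : (homogeneousComponent 1 P - ∑ i, C (coeff (Finsupp.single i 1) P) * X i).IsHomogeneous 1 :=
    (homogeneousComponent_isHomogeneous 1 P).sub (isHomogeneous_linearForm _)
  rw [← sub_eq_zero]
  ext e
  rw [coeff_zero]
  by_cases he : e.degree = 1
  · obtain ⟨a, ha⟩ : ∃ a, e a ≠ 0 := by
      by_contra hall
      push Not at hall
      have : e = 0 := Finsupp.ext hall
      rw [this, map_zero] at he
      exact zero_ne_one he
    rw [eq_single_of_degree_eq_one he ha, coeff_sub, coeff_homogeneousComponent, Finsupp.degree_single,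
      if_pos rfl, coeff_single_linearForm, sub_self]
  · exact hhom.coeff_eq_zero (by simpa [weight_one_eq_degree] using he)

/-- **THE RESET** (brick K22 (iii)): for `P ∈ 𝔪₀` with linear part `σ = Σ σ_i x_i`, modulo the new exceptional
letter `x_j` the transform `T₁P = chartTransform 1 (shear j b P)` is the constant `σ(w)` (`w = e_j + b`,
`σ(w) = σ_j + Σ_{i ≠ j} σ_i b_i`) plus the `x_j`-free linear form `Σ_{i ≠ j} σ_i x_i`: degree-`≥ 2` monomials
acquire a factor `x_j`, a linear monomial `x_i` (`i ≠ j`) becomes `x_i + b_i`, and `x_j` becomes `1`. [folklore] -/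
theorem chartTransform_one_shear_sub_linear_mem_span_X [DecidableEq K] (j : Fin 4) (b : Fin 4 → K)
    (P : MvPolynomial (Fin 4) K) (hP : P ∈ originIdeal K) :
    chartTransform 1 Finset.univ j (shear j b P) -
        (C (coeff (Finsupp.single j 1) P +
            ∑ i, coeff (Finsupp.single i 1) P * b i * (if i = j then 0 else 1)) +
          ∑ i ∈ Finset.univ.erase j, C (coeff (Finsupp.single i 1) P) * X i) ∈
      Ideal.span {(X j : MvPolynomial (Fin 4) K)} := by
  set L : MvPolynomial (Fin 4) K := C (coeff (Finsupp.single j 1) P +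
      ∑ i, coeff (Finsupp.single i 1) P * b i * (if i = j then 0 else 1)) +
    ∑ i ∈ Finset.univ.erase j, C (coeff (Finsupp.single i 1) P) * X i with hL
  set Q := P - homogeneousComponent 1 P with hQ
  -- degrees: `P` has no constant term, `Q` lives in degree `≥ 2`
  have hP1 : ∀ e ∈ P.support, 1 ≤ e.degree := forall_one_le_degree_of_mem_originIdeal hP
  have hQ2 : ∀ e ∈ Q.support, 2 ≤ e.degree := by
    intro e he
    rw [hQ, MvPolynomial.mem_support_iff, coeff_sub, coeff_homogeneousComponent] at he
    by_cases h1 : e.degree = 1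
    · rw [if_pos h1, sub_self] at he; exact absurd rfl he
    · rw [if_neg h1, sub_zero] at he
      have := hP1 e (MvPolynomial.mem_support_iff.mpr he)
      omega
  -- `σ_j ∘ shear` on the linear part is `x_j · L`
  have hsum : (∑ i, coeff (Finsupp.single i 1) P * b i * (if i = j then (0 : K) else 1)) =
      ∑ i ∈ Finset.univ.erase j, coeff (Finsupp.single i 1) P * b i := by
    rw [← Finset.add_sum_erase _ _ (Finset.mem_univ j), if_pos rfl, mul_zero, zero_add]
    exact Finset.sum_congr rfl fun i hi => by rw [if_neg (Finset.ne_of_mem_erase hi), mul_one]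
  have hlin : coordBlowupSubst K (↑(Finset.univ : Finset (Fin 4))) j (shear j b (homogeneousComponent 1 P)) =
      X j * L := by
    rw [homogeneousComponent_one_eq_linearForm]
    unfold shear
    rw [map_sum, map_sum, ← Finset.add_sum_erase _ _ (Finset.mem_univ j), map_mul, map_mul, aeval_C, aeval_X,
      if_pos rfl, algebraMap_eq, coordBlowupSubst_C, coordBlowupSubst_X_self]
    have hrest : ∑ i ∈ Finset.univ.erase j, coordBlowupSubst K (↑(Finset.univ : Finset (Fin 4))) j
        (aeval (fun i => if i = j then (X j : MvPolynomial (Fin 4) K) else X i + C (b i) * X j)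
          (C (coeff (Finsupp.single i 1) P) * X i)) =
        ∑ i ∈ Finset.univ.erase j, X j * (C (coeff (Finsupp.single i 1) P * b i) +
          C (coeff (Finsupp.single i 1) P) * X i) := by
      refine Finset.sum_congr rfl fun i hi => ?_
      have hij : i ≠ j := Finset.ne_of_mem_erase hi
      rw [map_mul, map_mul, aeval_C, aeval_X, if_neg hij, algebraMap_eq, coordBlowupSubst_C, map_add, map_mul,
        coordBlowupSubst_C, coordBlowupSubst_X_self,
        coordBlowupSubst_X_of_mem_of_ne K _ j (Finset.mem_coe.mpr (Finset.mem_univ i)) hij, C_mul]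
      ring
    rw [hrest, ← Finset.mul_sum, hL, hsum, map_add C, map_sum C, Finset.sum_add_distrib]
    ring
  -- `x_j · T₁(shear P) = σ_j(shear P) = x_j · L + x_j² · T₂(shear Q)`
  have hsplit : shear j b P = shear j b (homogeneousComponent 1 P) + shear j b Q := by
    rw [hQ]; unfold shear; rw [← map_add, add_sub_cancel]
  have h1 : (X j : MvPolynomial (Fin 4) K) * chartTransform 1 Finset.univ j (shear j b P) =
      X j * L + X j ^ 2 * chartTransform 2 Finset.univ j (shear j b Q) := by
    have hA := X_pow_mul_chartTransform_univ j (m := 1) (forall_le_degree_shear j b hP1)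
    rw [pow_one] at hA
    rw [hA, hsplit, map_add, hlin, ← X_pow_mul_chartTransform_univ j (forall_le_degree_shear j b hQ2)]
  have h2 : chartTransform 1 Finset.univ j (shear j b P) - L = X j * chartTransform 2 Finset.univ j (shear j b Q) := by
    apply mul_left_cancel₀ (X_ne_zero j)
    rw [mul_sub, h1, pow_two]
    ring
  rw [h2]
  exact Ideal.mem_span_singleton'.mpr ⟨chartTransform 2 Finset.univ j (shear j b Q), mul_comm _ _⟩

end ResCone

end Summit.ResolutionOfSingularities.ResolutionOfSingularities.Theorems.PIDim4
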